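import Literature.AlgebraicGeometry.HodgeTheory.SaitoGrFDeRhamCurveNetHolds
import Literature.AlgebraicGeometry.HodgeTheory.DivisorInduction
import Literature.AlgebraicGeometry.HodgeTheory.GysinHodgeClassLift
import Literature.AlgebraicGeometry.HodgeTheory.SupportedHodgeClassDescent
import Literature.AlgebraicGeometry.HodgeTheory.VanishingCohomologyNontrivialProofs
import Literature.AlgebraicGeometry.HodgeTheory.GysinKernelProofs
import HarnessLib

/-!
# Crux `ConiveauOneFailure` (stmt-HodgeConjecture-3540), route `SecondaryPeriods`, line `birth` —
# STUB S1 `stub_supportedClasses_le_surfaceGysin`: coniveau-one classes of a threefold are carried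
# by Gysin images of finitely many smooth projective surfaces

For a smooth projective threefold `Y/ℂ`, the coniveau-one part `N¹H³(Y) = supportedClasses Y 3 1`
of `H³(Y(ℂ); ℂ)` (classes dying off some divisor) lies in a FINITE sum of Gysin images
`g_{j*} H¹(S_j(ℂ); ℂ) → H³(Y(ℂ); ℂ)` of morphisms `g_j : S_j → Y` from smooth projective SURFACES
(`stub_supportedClasses_le_surfaceGysin`, the registered stub S1 of the reshaped birth skeleton of
the crux, verbatim). This is Deligne's *Hodge III* Cor. 8.2.8 (a class dying off `Z = ⋃ⱼ gⱼ(Sⱼ)` is a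
sum of Gysin images from a resolving family of `Z`) in the form Grothendieck uses on p. 300 of
*Hodge's general conjecture is false for trivial reasons*.

PROOF. Every input is a theorem of the tree.
* One class (`exists_surfaceFamily_mem_iSup_range_complexGysin`): `x ∈ N¹H³` dies off ONE closed `Z`
  of codimension `≥ 1` (`exists_isClosed_of_mem_supportedClasses`); `Z = ⋃ⱼ gⱼ(Sⱼ)` for finitely many
  `gⱼ : Sⱼ ⟶ Y` from smooth projective SURFACES (`exists_equidim_family_iUnion_range_eq` with `n = 2`:
  Hironaka on the components, padded to dimension exactly `2`); Deligne's Cor. 8.2.8, DISCHARGED in the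
  tree (`Deligne1974_ker_restrictCompl_eq_iSup_range_complexGysin_holds`, unfolded by
  `….mem_iSup_range_of_iUnion_range_eq`, Poincaré duality `OrientationFamily.hasPoincareDuality`), puts
  `x` in `⨆ⱼ ⨆ₐ ⨆_{a + 6 = 3 + 4} im (gⱼ)_*`, and only `a = 1` occurs.
* Finiteness: `H³(Y(ℂ); ℂ)` is finite-dimensional (`finite_complexBetti`), so `N¹H³(Y)` is spanned
  by a finite set `t`; the disjoint union over `x ∈ t` of the surface families of the first step is a
  finite family carrying `span t = N¹H³(Y)`.

References: P. Deligne, *Théorie de Hodge III*, Publ. Math. IHÉS 44 (1974), Cor. 8.2.8;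
A. Grothendieck, *Hodge's general conjecture is false for trivial reasons*, Topology 8 (1969), p. 300.
-/

-- every declaration of this problem lives in `Summit.HodgeConjecture.HodgeConjecture.…` (summit =
-- sub-problem), which `linter.dupNamespace` flags
set_option linter.dupNamespace false

noncomputable section

namespace Summit.HodgeConjecture.HodgeConjecture.Theorems

open CategoryTheory MonoidalCategory CartesianMonoidalCategory
open Literature.AlgebraicGeometry.Motives Literature.AlgebraicGeometry.HodgeTheory
  Literature.AlgebraicTopology.SingularHomology

/-- **One coniveau-one class of a threefold is carried by finitely many surface Gysin images.**
For `Y` smooth projective of dimension `3`, an orientation family `μ` and `x ∈ N¹H³(Y)`: `x` dies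
off one closed `Z ⊆ Y` of codimension `≥ 1` (`exists_isClosed_of_mem_supportedClasses`), which is
the joint image of finitely many `gⱼ : Sⱼ ⟶ Y` from smooth projective surfaces
(`exists_equidim_family_iUnion_range_eq`), so by Deligne's Cor. 8.2.8
(`Deligne1974_ker_restrictCompl_eq_iSup_range_complexGysin_holds`) `x ∈ Σⱼ (gⱼ)_* H¹(Sⱼ(ℂ); ℂ)`
(in `a + 2·3 = 3 + 2·2` only `a = 1` occurs). [cite: DeligneHodgeIII1974, Cor. 8.2.8] -/
theorem exists_surfaceFamily_mem_iSup_range_complexGysin (μ : OrientationFamily) {Y : SchemeOver ℂ}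
    (hY : IsSmoothProjective 3 Y) {x : complexBetti Y 3} (hx : x ∈ supportedClasses Y 3 1) :
    ∃ (ι : Type) (_ : Finite ι) (S : ι → SchemeOver ℂ) (hS : ∀ j, IsSmoothProjective 2 (S j))
      (g : ∀ j, S j ⟶ Y),
      x ∈ ⨆ j, LinearMap.range
        (complexGysin μ (hS j) hY (g j) (show 1 + 2 * 3 = 3 + 2 * 2 by norm_num)) := by
  obtain ⟨Z, hZ, hZ1, hxZ⟩ := exists_isClosed_of_mem_supportedClasses hx
  obtain ⟨ι, hι, S, hS, g, hZeq⟩ :=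
    exists_equidim_family_iUnion_range_eq (n := 2) hY hZ (fun z hz ↦ by exact_mod_cast hZ1 z hz)
  refine ⟨ι, hι, S, hS, g, ?_⟩
  have hmem := Deligne1974_ker_restrictCompl_eq_iSup_range_complexGysin_holds.mem_iSup_range_of_iUnion_range_eq
    μ μ.hasPoincareDuality hY (m := fun _ ↦ 2) hS g hZeq hxZ
  have hle : (⨆ (j : ι) (a : ℕ) (hab : a + 2 * 3 = 3 + 2 * 2),
      LinearMap.range (complexGysin μ (hS j) hY (g j) hab)) ≤
      ⨆ j, LinearMap.range
        (complexGysin μ (hS j) hY (g j) (show 1 + 2 * 3 = 3 + 2 * 2 by norm_num)) := by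
    refine iSup_le fun j ↦ iSup_le fun a ↦ iSup_le fun hab ↦ ?_
    obtain rfl : a = 1 := by omega
    exact le_iSup_of_le j le_rfl
  exact hle hmem

/-- **STUB S1 — coniveau-one classes of a smooth projective threefold are carried by Gysin images of
finitely many smooth projective surfaces** (registered stub `stub_supportedClasses_le_surfaceGysin` of
the birth skeleton of the crux `ConiveauOneFailure`, verbatim): for `Y` smooth projective of dimension
`3` there are an orientation family `μ` and finitely many `g_j : S_j ⟶ Y` from smooth projective
surfaces with `N¹H³(Y) ⊆ Σ_j g_{j*} H¹(S_j(ℂ); ℂ)`. Proof: `H³(Y(ℂ); ℂ)` is finite-dimensional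
(`finite_complexBetti`), so `N¹H³(Y)` is the span of a finite set `t`; each `x ∈ t` is carried by a
finite surface family (`exists_surfaceFamily_mem_iSup_range_complexGysin`: one divisor, Hironaka on its
components, Deligne's Cor. 8.2.8 — all discharged in the tree), and the disjoint union of these
families over `t` carries `span t`. [cite: DeligneHodgeIII1974, Cor. 8.2.8]
[cite: GrothendieckTopology1969, p. 300] -/
theorem stub_supportedClasses_le_surfaceGysin :
    ∀ ⦃Y : SchemeOver ℂ⦄ (hY : IsSmoothProjective 3 Y),
      ∃ (μ : OrientationFamily) (ι : Type) (_ : Finite ι) (S : ι → SchemeOver ℂ)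
        (hS : ∀ j, IsSmoothProjective 2 (S j)) (g : ∀ j, S j ⟶ Y),
        supportedClasses Y 3 1 ≤
          ⨆ j, LinearMap.range
            (complexGysin μ (hS j) hY (g j) (show 1 + 2 * 3 = 3 + 2 * 2 by norm_num)) := by
  intro Y hY
  let μ : OrientationFamily := fun _ _ h ↦ Classical.choice (ComplexPoints.isOrientableOver ℂ h)
  haveI := finite_complexBetti hY 3
  obtain ⟨t, ht⟩ : (supportedClasses Y 3 1).FG := IsNoetherian.noetherian _
  have hmem : ∀ x : t, (x : complexBetti Y 3) ∈ supportedClasses Y 3 1 := fun x ↦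
    ht ▸ Submodule.subset_span x.2
  choose ι hι S hS g hx using
    fun x : t ↦ exists_surfaceFamily_mem_iSup_range_complexGysin μ hY (hmem x)
  refine ⟨μ, Σ x : t, ι x, inferInstance, fun p ↦ S p.1 p.2, fun p ↦ hS p.1 p.2,
    fun p ↦ g p.1 p.2, ?_⟩
  rw [← ht, Submodule.span_le]
  intro x hxt
  have hle : (⨆ j, LinearMap.range (complexGysin μ (hS ⟨x, hxt⟩ j) hY (g ⟨x, hxt⟩ j)
      (show 1 + 2 * 3 = 3 + 2 * 2 by norm_num))) ≤
      ⨆ p : Σ x : t, ι x, LinearMap.range (complexGysin μ (hS p.1 p.2) hY (g p.1 p.2)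
        (show 1 + 2 * 3 = 3 + 2 * 2 by norm_num)) :=
    iSup_le fun j ↦ le_iSup_of_le ⟨⟨x, hxt⟩, j⟩ le_rfl
  exact hle (hx ⟨x, hxt⟩)

end Summit.HodgeConjecture.HodgeConjecture.Theorems

end
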